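import Summits.QuantumFields.BalabanUV.T4Continuum.Support.DirichletCornerCutout
import Summits.QuantumFields.BalabanUV.T4Continuum.Support.DirichletDipCutoffSmooth

/-!
# `BalabanUV.T4Continuum.Support.DirichletCornerCutoutEta` — NE2 (node U1a) formalisation swarm, sub-row `T4-U1a.S-NE2-D1-DIRICHLET°`, supplier item
# «Δ1-SKELETON» (file 9): THE CORNER BUMPS `Cb β κ₁ κ₂ = Π_λ (axis profile along λ)` AND THE CUT-OUT INDICATOR
# **`etaC = 1 − Π_{(β,κ₁,κ₂)} (1 − [β −μ-exposed, κ₁ ≠ κ₂ transversal]·Cb β κ₁ κ₂)`** — range, saturation (`Cb = 1 ⇒ etaC = 1`) and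
# UNCONDITIONAL smoothness `|Δ etaC| ≤ ℓ₁′`, `|Δ² etaC| ≤ ℓ₂′` at every site (unit b2b-balaban-t4-ne2-formalise-leaf-08, gen 7, file 9)

HONEST FRAMING.  Rung (B)+1 bookkeeping at MODEL level, finite torus; pure lattice combinatorics; NE2 (U1a) is NOT proved by this file;
spine PROVED 0/9 unchanged; NOT infinite volume, NOT the mass gap, NOT Clay.  HONEST DEPENDENCY (verbatim): «continuum YM on T⁴ ⇐ BetaPertH ∧
nine spine estimates (0/9 proved); BetaPertH ⇐ (D1) ∧ (D4) ∧ CAP+tail; G-an2-4 gates asym, D1 and NE2/3/4.»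

WHAT THIS FILE PROVES (0 sorry; files 4, 7, 8 BY NAME).  `cfac` ∕ `Cb` ∕ [shape] `CornerIdx` ∕ `gfac` ∕ `etaC`; ranges; **`etaC_eq_one_of_Cb`**;
`Cb_step` ∕ `Cb_second` (only the profile along the axis of motion moves; `Hp` along `μ` needs `M_μ ≥ 2`, automatic for an exposed block);
the active set of a site (`Aset x ×ˢ univ ×ˢ univ`, `≤ 3^d·d²` indices); **`etaC_step`** `≤ ell1C d R`, **`etaC_second`** `≤ ell2C d R` at
EVERY site of the torus, for every `S`, `d`, torus, `2 ≤ R`, `2 ≤ R′`, `2(R′ + R) ≤ n`.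

ABSOLUTE RULE (cell, verbatim): «No internally-minted statement may enter as a cited fact. Every hypothesis is either kernel-proved in
this package or a verbatim quotation of a PUBLISHED theorem with page reference. The manuscript(s) under audit are NOT citable for
their own disputed steps — they are the thing under adjudication; programme-internal (2001/route/tribunal) claims are never citable.»
[folklore] lattice bookkeeping; data definitions; no `def … : Prop` fact (`CornerIdx` is a decidable [shape] predicate on data).  NOT CLAIMED:
`etaC = 1` on the corner neighbourhoods (next file), the two-level law; NE2; NE3.
-/

noncomputable section

open scoped BigOperators
open Finset

namespace Summit.QuantumFields.BalabanUV.T4Continuum.DirichletCornerCutoutEta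

open Literature.MathematicalPhysics.QuantumFieldTheory.Balaban1983to89.B5Prop11Plancherel (Tor fine unitVec)
open Literature.MathematicalPhysics.QuantumFieldTheory.Balaban1983to89.B5Blocks16 (blockOf)
open Summit.QuantumFields.BalabanUV.T4Continuum.DirichletMonotoneCutoff (offsF)
open Summit.QuantumFields.BalabanUV.T4Continuum.ScaleProfile (qprof qprof_eq_zero lip1 lip2 lip1_nonneg lip2_nonneg prod_mem abs_prod_sub_prod_le
  abs_prod_second_le sum_le_card_mul)
open Summit.QuantumFields.BalabanUV.T4Continuum.DirichletDipCutoff (BotExp)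
open Summit.QuantumFields.BalabanUV.T4Continuum.DirichletDipCutoffAxis (AxisSmooth liftA liftA_step liftA_second liftA_add_of_ne liftA_sub_of_ne
  one_ne_zero_of_botExp abs_mul_sub_le abs_mul_second_le)
open Summit.QuantumFields.BalabanUV.T4Continuum.DirichletCornerCutout (Hp Dp Ep Hp_mem Dp_mem Ep_mem axisSmooth_Hp axisSmooth_Dp axisSmooth_Ep)
open Summit.QuantumFields.BalabanUV.T4Continuum.DirichletDipCutoffSmooth (Aset card_Aset_le)

variable {d : ℕ} (n : ℕ) [NeZero n] (M : Fin d → ℕ) [hM : ∀ μ, NeZero (M μ)] (S : Tor M → Prop) [DecidablePred S] (μ : Fin d) (R R' : ℕ)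

/-! ## §1 Corner bumps and the cut-out indicator -/

/-- the axis factor along `λ` of the corner bump of `(β, κ₁, κ₂)`: the bottom-plane slab along `μ`, the thin two-sided slabs along `κ₁, κ₂`,
the range-with-collar along every other axis. [folklore] -/
def cfac (β : Tor M) (κ₁ κ₂ lam : Fin d) (x : Tor (fine n M)) : ℝ :=
  if lam = μ then liftA n M lam (Hp (n := n) R R' (β lam)) x
  else if lam = κ₁ ∨ lam = κ₂ then liftA n M lam (Dp (n := n) R R' (β lam)) x
  else liftA n M lam (Ep (n := n) R R' (β lam)) x

/-- **the corner bump** `Cb β κ₁ κ₂ = Π_λ cfac λ`. [folklore] -/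
def Cb (β : Tor M) (κ₁ κ₂ : Fin d) (x : Tor (fine n M)) : ℝ := ∏ lam : Fin d, cfac n M μ R R' β κ₁ κ₂ lam x

/-- [shape] a valid corner index: `β` is `−μ`-exposed and `κ₁ ≠ κ₂` are transversal. [folklore] -/
def CornerIdx (β : Tor M) (κ₁ κ₂ : Fin d) : Prop := BotExp M S μ β ∧ κ₁ ≠ μ ∧ κ₂ ≠ μ ∧ κ₁ ≠ κ₂

/-- `CornerIdx` is decidable. [folklore] -/
instance (β : Tor M) (κ₁ κ₂ : Fin d) : Decidable (CornerIdx M S μ β κ₁ κ₂) := by unfold CornerIdx; infer_instance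

/-- the factor of the corner index `(β, κ₁, κ₂)` in the cut-out product. [folklore] -/
def gfac (β : Tor M) (κ₁ κ₂ : Fin d) (x : Tor (fine n M)) : ℝ := 1 - (if CornerIdx M S μ β κ₁ κ₂ then Cb n M μ R R' β κ₁ κ₂ x else 0)

/-- **THE CUT-OUT INDICATOR** `etaC = 1 − Π_{(β,κ₁,κ₂)} gfac`. [folklore] -/
def etaC (x : Tor (fine n M)) : ℝ := 1 - ∏ i : Tor M × Fin d × Fin d, gfac n M S μ R R' i.1 i.2.1 i.2.2 x

/-! ## §2 Ranges and saturation -/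

section Ranges

variable {n M S μ R R'} (hR : 2 ≤ R) (hn : 2 * (R' + R) ≤ n)
include hR hn

/-- `0 ≤ cfac ≤ 1`. [folklore] -/
theorem cfac_mem (β : Tor M) (κ₁ κ₂ lam : Fin d) (x : Tor (fine n M)) :
    0 ≤ cfac n M μ R R' β κ₁ κ₂ lam x ∧ cfac n M μ R R' β κ₁ κ₂ lam x ≤ 1 := by
  unfold cfac liftA; split_ifs
  · exact Hp_mem hR _ _ _
  · exact Dp_mem hR hn _ _ (offsF n M x lam).isLt
  · exact Ep_mem hR hn _ _ (offsF n M x lam).isLt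

/-- `0 ≤ Cb ≤ 1`. [folklore] -/
theorem Cb_mem (β : Tor M) (κ₁ κ₂ : Fin d) (x : Tor (fine n M)) : 0 ≤ Cb n M μ R R' β κ₁ κ₂ x ∧ Cb n M μ R R' β κ₁ κ₂ x ≤ 1 :=
  prod_mem _ fun lam _ => cfac_mem hR hn β κ₁ κ₂ lam x

/-- `0 ≤ gfac ≤ 1`. [folklore] -/
theorem gfac_mem (β : Tor M) (κ₁ κ₂ : Fin d) (x : Tor (fine n M)) : 0 ≤ gfac n M S μ R R' β κ₁ κ₂ x ∧ gfac n M S μ R R' β κ₁ κ₂ x ≤ 1 := by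
  have h := Cb_mem hR hn (μ := μ) β κ₁ κ₂ x
  unfold gfac; split_ifs <;> constructor <;> linarith [h.1, h.2]

/-- **`0 ≤ etaC ≤ 1`**. [folklore] -/
theorem etaC_mem (x : Tor (fine n M)) : 0 ≤ etaC n M S μ R R' x ∧ etaC n M S μ R R' x ≤ 1 := by
  have h := prod_mem (univ : Finset (Tor M × Fin d × Fin d)) fun i _ => gfac_mem hR hn (S := S) (μ := μ) i.1 i.2.1 i.2.2 x
  unfold etaC; constructor <;> linarith [h.1, h.2]

omit hR hn in
/-- **saturation**: a valid corner bump equal to `1` forces `etaC = 1`. [folklore] -/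
theorem etaC_eq_one_of_Cb {β : Tor M} {κ₁ κ₂ : Fin d} (hidx : CornerIdx M S μ β κ₁ κ₂) {x : Tor (fine n M)} (h : Cb n M μ R R' β κ₁ κ₂ x = 1) :
    etaC n M S μ R R' x = 1 := by
  unfold etaC
  rw [Finset.prod_eq_zero (Finset.mem_univ (β, κ₁, κ₂)) (by simp only [gfac, if_pos hidx, h, sub_self]), sub_zero]

omit hR hn in
/-- a corner bump equals `1` as soon as every axis factor does. [folklore] -/
theorem Cb_eq_one_of {β : Tor M} {κ₁ κ₂ : Fin d} {x : Tor (fine n M)} (h : ∀ lam, cfac n M μ R R' β κ₁ κ₂ lam x = 1) :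
    Cb n M μ R R' β κ₁ κ₂ x = 1 := Finset.prod_eq_one fun lam _ => h lam

end Ranges

/-! ## §3 Smoothness of the corner bumps and of `etaC` -/

section Smooth

variable {n M S μ R R'} (hR : 2 ≤ R) (hR' : 2 ≤ R') (hn : 2 * (R' + R) ≤ n)
include hR hR' hn

omit hR hR' hn in
/-- an axis factor is constant along every other axis. [folklore] -/
theorem cfac_add_of_ne (β : Tor M) (κ₁ κ₂ : Fin d) {lam ν : Fin d} (h : ν ≠ lam) (x : Tor (fine n M)) :
    cfac n M μ R R' β κ₁ κ₂ lam (x + unitVec (fine n M) ν) = cfac n M μ R R' β κ₁ κ₂ lam x := by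
  unfold cfac; split_ifs <;> exact liftA_add_of_ne lam _ h x

omit hR hR' hn in
/-- … and backwards. [folklore] -/
theorem cfac_sub_of_ne (β : Tor M) (κ₁ κ₂ : Fin d) {lam ν : Fin d} (h : ν ≠ lam) (x : Tor (fine n M)) :
    cfac n M μ R R' β κ₁ κ₂ lam (x - unitVec (fine n M) ν) = cfac n M μ R R' β κ₁ κ₂ lam x := by
  unfold cfac; split_ifs <;> exact liftA_sub_of_ne lam _ h x

omit [DecidablePred S] in
/-- the axis factor along `ν` is an axis profile along `ν` (for a valid corner index). [folklore] -/
theorem cfac_axis {β : Tor M} {κ₁ κ₂ : Fin d} (hidx : CornerIdx M S μ β κ₁ κ₂) (ν : Fin d) (x : Tor (fine n M)) :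
    |cfac n M μ R R' β κ₁ κ₂ ν (x + unitVec (fine n M) ν) - cfac n M μ R R' β κ₁ κ₂ ν x| ≤ 2 * lip1 R
      ∧ |2 * cfac n M μ R R' β κ₁ κ₂ ν x - cfac n M μ R R' β κ₁ κ₂ ν (x + unitVec (fine n M) ν) - cfac n M μ R R' β κ₁ κ₂ ν (x - unitVec (fine n M) ν)|
          ≤ 2 * lip2 R := by
  have hn3 : 3 ≤ n := by omega
  have hl1 := lip1_nonneg hR
  have hl2 : 0 ≤ lip2 R := lip2_nonneg
  unfold cfac
  by_cases h1 : ν = μ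
  · simp only [if_pos h1]
    subst h1
    have hF := axisSmooth_Hp (n := n) hR hR' hn (one_ne_zero_of_botExp hidx.1) (β ν)
    exact ⟨(liftA_step ν hF x).trans (by linarith), (liftA_second ν hF hn3 x).trans (by linarith)⟩
  · simp only [if_neg h1]
    by_cases h2 : ν = κ₁ ∨ ν = κ₂
    · simp only [if_pos h2]
      have hF := axisSmooth_Dp (n := n) hR hR' hn (β ν)
      exact ⟨liftA_step ν hF x, liftA_second ν hF hn3 x⟩
    · simp only [if_neg h2]
      have hF := axisSmooth_Ep (n := n) hR hR' hn (β ν)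
      exact ⟨liftA_step ν hF x, liftA_second ν hF hn3 x⟩

/-- the rest of a corner bump after taking out the factor along `ν`. [folklore] -/
def Crest (β : Tor M) (κ₁ κ₂ ν : Fin d) (x : Tor (fine n M)) : ℝ := ∏ lam ∈ univ.erase ν, cfac n M μ R R' β κ₁ κ₂ lam x

omit hR' in
/-- `0 ≤ Crest ≤ 1`. [folklore] -/
theorem Crest_mem (β : Tor M) (κ₁ κ₂ ν : Fin d) (x : Tor (fine n M)) :
    0 ≤ Crest (n := n) (M := M) (μ := μ) (R := R) (R' := R') β κ₁ κ₂ ν x ∧ Crest (n := n) (M := M) (μ := μ) (R := R) (R' := R') β κ₁ κ₂ ν x ≤ 1 :=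
  prod_mem _ fun lam _ => cfac_mem hR hn β κ₁ κ₂ lam x

omit hR hR' hn in
/-- `Crest_ν` is constant along `ν`. [folklore] -/
theorem Crest_add (β : Tor M) (κ₁ κ₂ ν : Fin d) (x : Tor (fine n M)) :
    Crest (n := n) (M := M) (μ := μ) (R := R) (R' := R') β κ₁ κ₂ ν (x + unitVec (fine n M) ν)
      = Crest (n := n) (M := M) (μ := μ) (R := R) (R' := R') β κ₁ κ₂ ν x :=
  Finset.prod_congr rfl fun _ hl => cfac_add_of_ne β κ₁ κ₂ (Finset.ne_of_mem_erase hl).symm x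

omit hR hR' hn in
/-- … and backwards. [folklore] -/
theorem Crest_sub (β : Tor M) (κ₁ κ₂ ν : Fin d) (x : Tor (fine n M)) :
    Crest (n := n) (M := M) (μ := μ) (R := R) (R' := R') β κ₁ κ₂ ν (x - unitVec (fine n M) ν)
      = Crest (n := n) (M := M) (μ := μ) (R := R) (R' := R') β κ₁ κ₂ ν x :=
  Finset.prod_congr rfl fun _ hl => cfac_sub_of_ne β κ₁ κ₂ (Finset.ne_of_mem_erase hl).symm x

omit hR hR' hn in
/-- `Cb = cfac_ν · Crest_ν`. [folklore] -/
theorem Cb_eq_mul (β : Tor M) (κ₁ κ₂ ν : Fin d) (x : Tor (fine n M)) :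
    Cb n M μ R R' β κ₁ κ₂ x = cfac n M μ R R' β κ₁ κ₂ ν x * Crest (n := n) (M := M) (μ := μ) (R := R) (R' := R') β κ₁ κ₂ ν x := by
  unfold Cb Crest; exact (Finset.mul_prod_erase univ (fun lam => cfac n M μ R R' β κ₁ κ₂ lam x) (Finset.mem_univ ν)).symm

omit [DecidablePred S] in
/-- **corner bump steps and bends** along every axis at every site: `≤ 2·lip1 R`, `≤ 2·lip2 R`. [folklore] -/
theorem Cb_axis {β : Tor M} {κ₁ κ₂ : Fin d} (hidx : CornerIdx M S μ β κ₁ κ₂) (ν : Fin d) (x : Tor (fine n M)) :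
    |Cb n M μ R R' β κ₁ κ₂ (x + unitVec (fine n M) ν) - Cb n M μ R R' β κ₁ κ₂ x| ≤ 2 * lip1 R
      ∧ |2 * Cb n M μ R R' β κ₁ κ₂ x - Cb n M μ R R' β κ₁ κ₂ (x + unitVec (fine n M) ν) - Cb n M μ R R' β κ₁ κ₂ (x - unitVec (fine n M) ν)| ≤ 2 * lip2 R := by
  obtain ⟨h1, h2⟩ := cfac_axis hR hR' hn hidx ν x
  have hc := Crest_mem hR hn (μ := μ) (R' := R') β κ₁ κ₂ ν x
  rw [Cb_eq_mul β κ₁ κ₂ ν, Cb_eq_mul β κ₁ κ₂ ν, Cb_eq_mul β κ₁ κ₂ ν, Crest_add, Crest_sub, mul_comm (cfac n M μ R R' β κ₁ κ₂ ν (x + _)),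
    mul_comm (cfac n M μ R R' β κ₁ κ₂ ν (x - _)), mul_comm (cfac n M μ R R' β κ₁ κ₂ ν x)]
  exact ⟨(abs_mul_sub_le hc.1 hc.2).trans h1, (abs_mul_second_le hc.1 hc.2).trans h2⟩

/-- the cut-out factors step and bend by the same amounts (a constant factor does not move at all). [folklore] -/
theorem gfac_axis (β : Tor M) (κ₁ κ₂ ν : Fin d) (x : Tor (fine n M)) :
    |gfac n M S μ R R' β κ₁ κ₂ (x + unitVec (fine n M) ν) - gfac n M S μ R R' β κ₁ κ₂ x| ≤ 2 * lip1 R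
      ∧ |gfac n M S μ R R' β κ₁ κ₂ (x + unitVec (fine n M) ν) + gfac n M S μ R R' β κ₁ κ₂ (x - unitVec (fine n M) ν)
          - 2 * gfac n M S μ R R' β κ₁ κ₂ x| ≤ 2 * lip2 R := by
  have hl1 := lip1_nonneg hR
  have hl2 : 0 ≤ lip2 R := lip2_nonneg
  unfold gfac
  by_cases hidx : CornerIdx M S μ β κ₁ κ₂
  · simp only [if_pos hidx]
    obtain ⟨h1, h2⟩ := Cb_axis hR hR' hn hidx ν x
    constructor
    · rw [show (1 - Cb n M μ R R' β κ₁ κ₂ (x + unitVec (fine n M) ν)) - (1 - Cb n M μ R R' β κ₁ κ₂ x)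
          = -(Cb n M μ R R' β κ₁ κ₂ (x + unitVec (fine n M) ν) - Cb n M μ R R' β κ₁ κ₂ x) by ring, abs_neg]; exact h1
    · rw [show (1 - Cb n M μ R R' β κ₁ κ₂ (x + unitVec (fine n M) ν)) + (1 - Cb n M μ R R' β κ₁ κ₂ (x - unitVec (fine n M) ν))
          - 2 * (1 - Cb n M μ R R' β κ₁ κ₂ x)
          = 2 * Cb n M μ R R' β κ₁ κ₂ x - Cb n M μ R R' β κ₁ κ₂ (x + unitVec (fine n M) ν) - Cb n M μ R R' β κ₁ κ₂ (x - unitVec (fine n M) ν) by ring]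
      exact h2
  · simp only [if_neg hidx]; norm_num; constructor <;> positivity

/-! ### The active corner indices of a site -/

omit hR hR' hn in
/-- a non-zero axis factor puts the coordinate of `β` within one block step. [folklore] -/
theorem near_of_cfac_ne_zero {β : Tor M} {κ₁ κ₂ lam : Fin d} {x : Tor (fine n M)} (h : cfac n M μ R R' β κ₁ κ₂ lam x ≠ 0) :
    β lam = blockOf n M x lam ∨ β lam = blockOf n M x lam + 1 ∨ β lam = blockOf n M x lam - 1 := by
  unfold cfac liftA at h
  split_ifs at h with h1 h2
  · unfold Hp at h
    split_ifs at h with ha hb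
    · exact Or.inl ha.symm
    · exact Or.inr (Or.inl (by rw [hb, sub_add_cancel]))
    · exact absurd rfl h
  · unfold Dp at h
    by_cases ha : blockOf n M x lam = β lam
    · exact Or.inl ha.symm
    · rw [if_neg ha] at h
      by_cases hb : blockOf n M x lam = β lam + 1
      · exact Or.inr (Or.inr (by rw [hb, add_sub_cancel_right]))
      · rw [if_neg hb, zero_add] at h
        split_ifs at h with hc
        · exact Or.inr (Or.inl (by rw [hc, sub_add_cancel]))
        · exact absurd rfl h
  · unfold Ep at h
    by_cases ha : blockOf n M x lam = β lam
    · exact Or.inl ha.symm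
    · rw [if_neg ha] at h
      by_cases hb : blockOf n M x lam = β lam + 1
      · exact Or.inr (Or.inr (by rw [hb, add_sub_cancel_right]))
      · rw [if_neg hb, zero_add] at h
        split_ifs at h with hc
        · exact Or.inr (Or.inl (by rw [hc, sub_add_cancel]))
        · exact absurd rfl h

omit hR hR' hn in
/-- a non-zero corner bump comes from an active block. [folklore] -/
theorem mem_Aset_of_Cb_ne_zero {β : Tor M} {κ₁ κ₂ : Fin d} {x : Tor (fine n M)} (h : Cb n M μ R R' β κ₁ κ₂ x ≠ 0) : β ∈ Aset n M x := by
  have hf : ∀ lam, cfac n M μ R R' β κ₁ κ₂ lam x ≠ 0 := fun lam => (Finset.prod_ne_zero_iff.mp h) lam (Finset.mem_univ _)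
  classical
  refine Finset.mem_image.mpr ⟨fun ν => (if β ν = blockOf n M x ν then 1 else if β ν = blockOf n M x ν + 1 then 2 else 0 : Fin 3),
    Finset.mem_univ _, ?_⟩
  funext ν
  dsimp only
  by_cases h1 : β ν = blockOf n M x ν
  · rw [if_pos h1, Fin.val_one, Nat.cast_one, h1]; ring
  · by_cases h2 : β ν = blockOf n M x ν + 1
    · rw [if_neg h1, if_pos h2, Fin.val_two, Nat.cast_ofNat, h2]; ring
    · rw [if_neg h1, if_neg h2, Fin.val_zero, Nat.cast_zero]
      rcases near_of_cfac_ne_zero (hf ν) with h3 | h3 | h3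
      · exact absurd h3 h1
      · exact absurd h3 h2
      · rw [h3]; ring

omit hR hR' hn in
/-- off the active set, the cut-out factor is `1`. [folklore] -/
theorem gfac_eq_one_of_not_mem {β : Tor M} {κ₁ κ₂ : Fin d} {x : Tor (fine n M)} (h : β ∉ Aset n M x) : gfac n M S μ R R' β κ₁ κ₂ x = 1 := by
  unfold gfac
  split_ifs
  · by_cases hC : Cb n M μ R R' β κ₁ κ₂ x = 0
    · rw [hC, sub_zero]
    · exact absurd (mem_Aset_of_Cb_ne_zero hC) h
  · rw [sub_zero]

/-- the first-difference constant of `etaC`: `ℓ₁′ = 3·3^d·d²·(2·lip1 R)`. [folklore] -/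
def ell1C (d R : ℕ) : ℝ := 3 * 3 ^ d * d ^ 2 * (2 * lip1 R)

/-- the second-difference constant of `etaC`: `ℓ₂′ = 3·3^d·d²·(2·lip2 R) + 2ℓ₁′²`. [folklore] -/
def ell2C (d R : ℕ) : ℝ := 3 * 3 ^ d * d ^ 2 * (2 * lip2 R) + 2 * ell1C d R ^ 2

omit hR hR' hn in
/-- the active index set of a triple and its size. [folklore] -/
theorem card_active_le (x : Tor (fine n M)) (ν : Fin d) :
    (((Aset n M x ∪ Aset n M (x + unitVec (fine n M) ν) ∪ Aset n M (x - unitVec (fine n M) ν)) ×ˢ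
        ((univ : Finset (Fin d)) ×ˢ (univ : Finset (Fin d)))).card : ℝ) ≤ 3 * 3 ^ d * d ^ 2 := by
  have h1 := card_Aset_le n M x
  have h2 := card_Aset_le n M (x + unitVec (fine n M) ν)
  have h3 := card_Aset_le n M (x - unitVec (fine n M) ν)
  have hu := (Finset.card_union_le _ _).trans (add_le_add ((Finset.card_union_le _ _).trans (add_le_add h1 h2)) h3)
  rw [Finset.card_product, Finset.card_product, Finset.card_univ, Fintype.card_fin]
  have : ((Aset n M x ∪ Aset n M (x + unitVec (fine n M) ν) ∪ Aset n M (x - unitVec (fine n M) ν)).card : ℝ) ≤ 3 * 3 ^ d := by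
    have : ((Aset n M x ∪ Aset n M (x + unitVec (fine n M) ν) ∪ Aset n M (x - unitVec (fine n M) ν)).card : ℝ) ≤ ((3 ^ d + 3 ^ d + 3 ^ d : ℕ) : ℝ) := by
      exact_mod_cast hu
    push_cast at this; linarith
  push_cast
  nlinarith [show (0 : ℝ) ≤ (d : ℝ) ^ 2 by positivity]

/-- **`etaC` first differences: `≤ ℓ₁′` at every site.** [folklore] -/
theorem etaC_step (ν : Fin d) (x : Tor (fine n M)) : |etaC n M S μ R R' (x + unitVec (fine n M) ν) - etaC n M S μ R R' x| ≤ ell1C d R := by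
  classical
  have hl1 := lip1_nonneg hR
  unfold etaC
  rw [show (1 - ∏ i : Tor M × Fin d × Fin d, gfac n M S μ R R' i.1 i.2.1 i.2.2 (x + unitVec (fine n M) ν))
      - (1 - ∏ i : Tor M × Fin d × Fin d, gfac n M S μ R R' i.1 i.2.1 i.2.2 x)
      = -(∏ i : Tor M × Fin d × Fin d, gfac n M S μ R R' i.1 i.2.1 i.2.2 (x + unitVec (fine n M) ν)
          - ∏ i : Tor M × Fin d × Fin d, gfac n M S μ R R' i.1 i.2.1 i.2.2 x) by ring, abs_neg]
  refine (abs_prod_sub_prod_le _ (fun i _ => gfac_mem hR hn _ _ _ _) (fun i _ => gfac_mem hR hn _ _ _ _)).trans ?_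
  set A := (Aset n M x ∪ Aset n M (x + unitVec (fine n M) ν) ∪ Aset n M (x - unitVec (fine n M) ν)) ×ˢ
    ((univ : Finset (Fin d)) ×ˢ (univ : Finset (Fin d))) with hA
  rw [← Finset.sum_subset (Finset.subset_univ A) (fun i _ hi => by
    have hβ : i.1 ∉ Aset n M x ∧ i.1 ∉ Aset n M (x + unitVec (fine n M) ν) := by
      simp only [hA, Finset.mem_product, Finset.mem_union, Finset.mem_univ, and_true, not_or] at hi; exact ⟨hi.1.1, hi.1.2⟩
    rw [gfac_eq_one_of_not_mem hβ.2, gfac_eq_one_of_not_mem hβ.1, sub_self, abs_zero])]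
  calc ∑ i ∈ A, |gfac n M S μ R R' i.1 i.2.1 i.2.2 (x + unitVec (fine n M) ν) - gfac n M S μ R R' i.1 i.2.1 i.2.2 x|
      ≤ A.card * (2 * lip1 R) := sum_le_card_mul fun i _ => (gfac_axis hR hR' hn i.1 i.2.1 i.2.2 ν x).1
    _ ≤ 3 * 3 ^ d * d ^ 2 * (2 * lip1 R) := mul_le_mul_of_nonneg_right (card_active_le (n := n) (M := M) x ν) (by positivity)

/-- **`etaC` second differences: `≤ ℓ₂′` at every site.** [folklore] -/
theorem etaC_second (ν : Fin d) (x : Tor (fine n M)) :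
    |2 * etaC n M S μ R R' x - etaC n M S μ R R' (x + unitVec (fine n M) ν) - etaC n M S μ R R' (x - unitVec (fine n M) ν)| ≤ ell2C d R := by
  classical
  have hl1 := lip1_nonneg hR
  have hl2 : 0 ≤ lip2 R := lip2_nonneg
  unfold etaC
  rw [show 2 * (1 - ∏ i : Tor M × Fin d × Fin d, gfac n M S μ R R' i.1 i.2.1 i.2.2 x)
      - (1 - ∏ i : Tor M × Fin d × Fin d, gfac n M S μ R R' i.1 i.2.1 i.2.2 (x + unitVec (fine n M) ν))
      - (1 - ∏ i : Tor M × Fin d × Fin d, gfac n M S μ R R' i.1 i.2.1 i.2.2 (x - unitVec (fine n M) ν))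
      = ∏ i : Tor M × Fin d × Fin d, gfac n M S μ R R' i.1 i.2.1 i.2.2 (x + unitVec (fine n M) ν)
        + ∏ i : Tor M × Fin d × Fin d, gfac n M S μ R R' i.1 i.2.1 i.2.2 (x - unitVec (fine n M) ν)
        - 2 * ∏ i : Tor M × Fin d × Fin d, gfac n M S μ R R' i.1 i.2.1 i.2.2 x by ring]
  refine (abs_prod_second_le _ (fun i _ => gfac_mem hR hn _ _ _ _) (fun i _ => gfac_mem hR hn _ _ _ _)
    (fun i _ => gfac_mem hR hn _ _ _ _)).trans ?_
  set A := (Aset n M x ∪ Aset n M (x + unitVec (fine n M) ν) ∪ Aset n M (x - unitVec (fine n M) ν)) ×ˢ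
    ((univ : Finset (Fin d)) ×ˢ (univ : Finset (Fin d))) with hA
  have hcard := card_active_le (n := n) (M := M) x ν
  have hoff : ∀ i ∈ (univ : Finset (Tor M × Fin d × Fin d)), i ∉ A →
      gfac n M S μ R R' i.1 i.2.1 i.2.2 (x + unitVec (fine n M) ν) = 1 ∧ gfac n M S μ R R' i.1 i.2.1 i.2.2 x = 1
        ∧ gfac n M S μ R R' i.1 i.2.1 i.2.2 (x - unitVec (fine n M) ν) = 1 := by
    intro i _ hi
    simp only [hA, Finset.mem_product, Finset.mem_union, Finset.mem_univ, and_true, not_or] at hi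
    exact ⟨gfac_eq_one_of_not_mem hi.1.2, gfac_eq_one_of_not_mem hi.1.1, gfac_eq_one_of_not_mem hi.2⟩
  have hS2 : ∑ i : Tor M × Fin d × Fin d, |gfac n M S μ R R' i.1 i.2.1 i.2.2 (x + unitVec (fine n M) ν)
      + gfac n M S μ R R' i.1 i.2.1 i.2.2 (x - unitVec (fine n M) ν) - 2 * gfac n M S μ R R' i.1 i.2.1 i.2.2 x| ≤ 3 * 3 ^ d * d ^ 2 * (2 * lip2 R) := by
    rw [← Finset.sum_subset (Finset.subset_univ A) (fun i hi hi' => by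
      obtain ⟨e1, e2, e3⟩ := hoff i hi hi'; rw [e1, e2, e3]; norm_num)]
    calc ∑ i ∈ A, |gfac n M S μ R R' i.1 i.2.1 i.2.2 (x + unitVec (fine n M) ν) + gfac n M S μ R R' i.1 i.2.1 i.2.2 (x - unitVec (fine n M) ν)
          - 2 * gfac n M S μ R R' i.1 i.2.1 i.2.2 x|
        ≤ A.card * (2 * lip2 R) := sum_le_card_mul fun i _ => (gfac_axis hR hR' hn i.1 i.2.1 i.2.2 ν x).2
      _ ≤ 3 * 3 ^ d * d ^ 2 * (2 * lip2 R) := mul_le_mul_of_nonneg_right hcard (by positivity)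
  have hSf : ∑ i : Tor M × Fin d × Fin d, |gfac n M S μ R R' i.1 i.2.1 i.2.2 (x + unitVec (fine n M) ν) - gfac n M S μ R R' i.1 i.2.1 i.2.2 x|
      ≤ ell1C d R := by
    rw [← Finset.sum_subset (Finset.subset_univ A) (fun i hi hi' => by
      obtain ⟨e1, e2, -⟩ := hoff i hi hi'; rw [e1, e2, sub_self, abs_zero])]
    calc ∑ i ∈ A, |gfac n M S μ R R' i.1 i.2.1 i.2.2 (x + unitVec (fine n M) ν) - gfac n M S μ R R' i.1 i.2.1 i.2.2 x|
        ≤ A.card * (2 * lip1 R) := sum_le_card_mul fun i _ => (gfac_axis hR hR' hn i.1 i.2.1 i.2.2 ν x).1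
      _ ≤ 3 * 3 ^ d * d ^ 2 * (2 * lip1 R) := mul_le_mul_of_nonneg_right hcard (by positivity)
  have hSh : ∑ i : Tor M × Fin d × Fin d, |gfac n M S μ R R' i.1 i.2.1 i.2.2 (x - unitVec (fine n M) ν) - gfac n M S μ R R' i.1 i.2.1 i.2.2 x|
      ≤ ell1C d R := by
    rw [← Finset.sum_subset (Finset.subset_univ A) (fun i hi hi' => by
      obtain ⟨-, e2, e3⟩ := hoff i hi hi'; rw [e3, e2, sub_self, abs_zero])]
    have hterm : ∀ i ∈ A, |gfac n M S μ R R' i.1 i.2.1 i.2.2 (x - unitVec (fine n M) ν) - gfac n M S μ R R' i.1 i.2.1 i.2.2 x| ≤ 2 * lip1 R := by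
      intro i _
      have := (gfac_axis hR hR' hn (S := S) (μ := μ) i.1 i.2.1 i.2.2 ν (x - unitVec (fine n M) ν)).1
      rw [sub_add_cancel] at this
      rwa [abs_sub_comm] at this
    calc ∑ i ∈ A, |gfac n M S μ R R' i.1 i.2.1 i.2.2 (x - unitVec (fine n M) ν) - gfac n M S μ R R' i.1 i.2.1 i.2.2 x|
        ≤ A.card * (2 * lip1 R) := sum_le_card_mul hterm
      _ ≤ 3 * 3 ^ d * d ^ 2 * (2 * lip1 R) := mul_le_mul_of_nonneg_right hcard (by positivity)
  have he1 : 0 ≤ ell1C d R := by unfold ell1C; positivity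
  have hS0 : 0 ≤ ∑ i : Tor M × Fin d × Fin d, |gfac n M S μ R R' i.1 i.2.1 i.2.2 (x + unitVec (fine n M) ν) - gfac n M S μ R R' i.1 i.2.1 i.2.2 x| :=
    Finset.sum_nonneg fun _ _ => abs_nonneg _
  have hS1 : 0 ≤ ∑ i : Tor M × Fin d × Fin d, |gfac n M S μ R R' i.1 i.2.1 i.2.2 (x - unitVec (fine n M) ν) - gfac n M S μ R R' i.1 i.2.1 i.2.2 x| :=
    Finset.sum_nonneg fun _ _ => abs_nonneg _
  unfold ell2C
  nlinarith [pow_le_pow_left₀ hS0 hSf 2, pow_le_pow_left₀ hS1 hSh 2]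

end Smooth

end Summit.QuantumFields.BalabanUV.T4Continuum.DirichletCornerCutoutEta

end
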